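import Literature.AlgebraicGeometry.Resolution.SpreadModelDataRestrict
import Literature.AlgebraicGeometry.Resolution.SpreadIdealSheafInclusion
import Literature.AlgebraicGeometry.Resolution.BoundaryEquivalence
import Literature.AlgebraicGeometry.Resolution.SpreadModelTower
import Literature.AlgebraicGeometry.Resolution.BlowupSequencesSingleOff
import HarnessLib

/-!
# Spreading out the shape of a resolution: the single blow-up of `𝓘` off a closed subset

Topic: `Literature/AlgebraicGeometry/Resolution`. The clause-(ii) half of the spreading-out
argument for `SpreadsShapedFromGenericPoint` (`CanonicalResolutionSpread.lean`; BGMW 2011,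
Thm. 8.0.5 (2) with Cor. 8.0.6–8.0.7). Setting (`SpreadModelTower.lean`): a Noetherian domain
`A` with fraction field `K`, a family `q : X → Spec A` of finite type with generic fibre
`jK : X_K → X` (`IsPullback jK qK q (Spec K → Spec A)`), a multiple blow-up `s` of `X`, an ideal
sheaf `𝓘` and a CLOSED subset `Z ⊆ X` (in the application: the image of the non-smooth locus of
`V(𝓘) → Spec A`). The shape "`s` is, off `Z`, the single blow-up of `𝓘`"
(`CentreSeq.IsSingleOff`, `BlowupSequencesSingleOff.lean`) spreads out from the generic fibre:

* `CentreSeq.CentresOverAt a q s T`, `CentreSeq.SingleOffAt a q s Z 𝓘` — the POINTWISE forms,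
  at the points of the tower over the basic open `D(a)`, of `CentresOver` and `IsSingleOff`
  (centres supported over `Z`; one centre with the same STALKS as `𝓘` off `Z`; then centres over
  `Z`), monotone in `D(a)` (`mono`);
* `CentreSeq.CentresOverAt.centresOver_restrict`, `CentreSeq.SingleOffAt.isSingleOff_restrict` —
  **restriction**: along an open immersion `j` whose image is the set of points over `D(a)`,
  `s|_{j}` has its centres over `j⁻¹ T`, resp. is the single blow-up of `j^*𝓘` off `j⁻¹ Z`;
* `exists_forall_mem_of_support_comap_subset` — **a centre supported over `Z` generically is
  supported over `Z` at the points over some `D(a)`, `a ≠ 0`**: with `H` the vanishing ideal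
  sheaf of `Z`, `(jK^*H)ᴺ ⊆ jK^*C` on the Noetherian generic fibre
  (`exists_pow_succ_le_of_support_subset`), an inclusion which spreads to `q⁻¹ D(a)`
  (`exists_comap_ι_le_comap_ι_of_generic`, `SpreadIdealSheafInclusion.lean`) and is read on
  stalks;
* `exists_forall_stalkIdeal_eq_of_eqOff_comap` — **two ideal sheaves agreeing off `jK⁻¹ Z` on
  the generic fibre have the same stalks off `Z` at the points over some `D(a)`**: the equality
  of restrictions to the open `X ∖ Z`, an `A`-scheme of finite type with generic fibre
  `X_K ∖ jK⁻¹ Z` (`isPullback_morphismRestrict`), spreads (`exists_comap_ι_eq_comap_ι_of_generic`);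
* `CentreSeq.exists_centresOverAt`, `CentreSeq.exists_singleOffAt` — **the spreading
  inductions** along the tower (the blow-up of `X` along `C` has generic fibre the blow-up of
  `X_K` along `jK^*C`, `blowup.isPullback_comapMap`);
* `CentreSeq.exists_isSingleOff_restrict` — **conclusion**: if `jK^*(s)` is the single blow-up of
  `jK^*𝓘` off `jK⁻¹ Z`, then for some `a ≠ 0` and every `b` with `D(b) ⊆ D(a)`, the restriction
  of `s` to the preimage of `D(b)` is the single blow-up of `𝓘` off `Z` there — whence, by
  `IsSingleOff.comap` and `IsSingleOff.isExtensionOfSingle_restrict`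
  (`BlowupSequencesSingleOff.lean`), clause (ii) of BGMW Thm. 8.0.5 in every fibre over `D(b)`.

## Sources

* E. Bierstone, D. Grigoriev, P. Milman, J. Włodarczyk, *Effective Hironaka resolution and its
  complexity*, Asian J. Math. 15 (2011), arXiv:1206.3090: Thm. 8.0.5 (2), Cor. 8.0.6–8.0.7,
  Def. 3.1.5. [BierstoneGrigorievMilmanWlodarczyk2011]
* A. Grothendieck, J. Dieudonné, EGA IV₃ (1966), §8–§9 (spreading out over a dense open of the
  base). [folklore]
-/

noncomputable section

open CategoryTheory CategoryTheory.Limits AlgebraicGeometry TopologicalSpace PrimeSpectrum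

namespace Literature.AlgebraicGeometry.Resolution

universe u

open Scheme.IdealSheafData

/-! ## Local helpers

Private copies of the generalities of `SpreadModelDataSpread.lean` (ideals under ring
isomorphisms, stalks from restrictions to an open, Mathlib's chosen generic fibre versus a given
one), so that this file does not depend on that one. -/

section LocalHelpers

variable {A : Type u} [CommRing A] {X : Scheme.{u}}

/-- Ideals with the same extension along a ring isomorphism are equal. [folklore] -/
private theorem ideal_eq_of_map_ringEquiv_eq_loc {R S : Type*} [CommRing R] [CommRing S] (e : R ≃+* S)
    {P Q : Ideal R} (h : P.map e.toRingHom = Q.map e.toRingHom) : P = Q := by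
  have h1 : (P.map e.toRingHom).map e.symm.toRingHom = (Q.map e.toRingHom).map e.symm.toRingHom := by
    rw [h]
  have h2 : e.symm.toRingHom.comp e.toRingHom = RingHom.id _ := RingHom.ext fun r => e.symm_apply_apply r
  rwa [Ideal.map_map, Ideal.map_map, h2, Ideal.map_id, Ideal.map_id] at h1

/-- Ideals with ordered extensions along a ring isomorphism are ordered. [folklore] -/
private theorem ideal_le_of_map_ringEquiv_le_loc {R S : Type*} [CommRing R] [CommRing S] (e : R ≃+* S)
    {P Q : Ideal R} (h : P.map e.toRingHom ≤ Q.map e.toRingHom) : P ≤ Q := by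
  have h1 : (P.map e.toRingHom).map e.symm.toRingHom ≤ (Q.map e.toRingHom).map e.symm.toRingHom :=
    Ideal.map_mono h
  have h2 : e.symm.toRingHom.comp e.toRingHom = RingHom.id _ := RingHom.ext fun r => e.symm_apply_apply r
  rwa [Ideal.map_map, Ideal.map_map, h2, Ideal.map_id, Ideal.map_id] at h1

/-- Stalks from an equality of restrictions to an open: if `I|_U = J|_U` then `I_x = J_x` at the
points of `U`. [folklore] -/
private theorem stalkIdeal_eq_of_comap_ι_eq_loc {U : X.Opens} {I J : X.IdealSheafData}
    (h : I.comap U.ι = J.comap U.ι) {x : X} (hx : x ∈ U) : stalkIdeal I x = stalkIdeal J x := by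
  have key := congrArg (fun L => stalkIdeal L (⟨x, hx⟩ : U)) h
  simp only [stalkIdeal_comap_eq_map_stalkMap] at key
  exact ideal_eq_of_map_ringEquiv_eq_loc (asIso (U.ι.stalkMap ⟨x, hx⟩)).commRingCatIsoToRingEquiv key

/-- Stalks from an inequality of restrictions to an open. [folklore] -/
private theorem stalkIdeal_le_of_comap_ι_le_loc {U : X.Opens} {I J : X.IdealSheafData}
    (h : I.comap U.ι ≤ J.comap U.ι) {x : X} (hx : x ∈ U) : stalkIdeal I x ≤ stalkIdeal J x := by
  have key : stalkIdeal (I.comap U.ι) ⟨x, hx⟩ ≤ stalkIdeal (J.comap U.ι) ⟨x, hx⟩ := stalkIdeal_mono h _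
  rw [stalkIdeal_comap_eq_map_stalkMap, stalkIdeal_comap_eq_map_stalkMap] at key
  exact ideal_le_of_map_ringEquiv_le_loc (asIso (U.ι.stalkMap ⟨x, hx⟩)).commRingCatIsoToRingEquiv key

variable (K : Type u) [Field K] [Algebra A K] {XK : Scheme.{u}} (q : X ⟶ Spec (.of A))
  {jK : XK ⟶ X} {qK : XK ⟶ Spec (.of K)} (HK : IsPullback jK qK q (specOfAlgebra A K))

include HK in
/-- Pull-backs along Mathlib's chosen generic fibre versus a given one. [folklore] -/
private theorem comap_pullback_fst_eq_comap_comap_loc (I : X.IdealSheafData) :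
    I.comap (pullback.fst q (specOfAlgebra A K)) = (I.comap jK).comap HK.isoPullback.inv := by
  rw [← comap_comp, HK.isoPullback_inv_fst]

end LocalHelpers

/-! ## Powers versus supports on a Noetherian scheme; stalks along open immersions -/

section Noetherian

variable {X : Scheme.{u}}

/-- **On a Noetherian scheme, an ideal sheaf contained in the radical of another has a power
contained in it** (finitely many affine charts, on each of which the ideal of sections is
finitely generated, `Ideal.exists_pow_le_of_le_radical_of_fg`; the inclusion of the power is
then read on stalks, `le_of_forall_stalkIdeal_le`). [folklore] -/
theorem exists_pow_succ_le_of_le_radical [IsLocallyNoetherian X] [CompactSpace X]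
    {I J : X.IdealSheafData} (h : I ≤ J.radical) : ∃ N : ℕ, I ^ (N + 1) ≤ J := by
  obtain ⟨t, ht⟩ := Limits.exists_finset_affineOpens_iSup_eq_top X
  have hloc : ∀ U : X.affineOpens, ∃ n : ℕ, I.ideal U ^ n ≤ J.ideal U := fun U => by
    haveI : IsNoetherianRing Γ(X, U) := IsLocallyNoetherian.component_noetherian U
    have hU : I.ideal U ≤ (J.ideal U).radical := by
      rw [← Scheme.IdealSheafData.radical_ideal]
      exact (Scheme.IdealSheafData.le_def.mp h) U
    exact Ideal.exists_pow_le_of_le_radical_of_fg hU (IsNoetherian.noetherian _)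
  choose nU hnU using hloc
  refine ⟨t.sup nU, le_of_forall_stalkIdeal_le fun x => ?_⟩
  have hx : x ∈ (⨆ V ∈ t, (V : X.Opens)) := ht (Opens.mem_top x)
  obtain ⟨V, hV⟩ := Opens.mem_iSup.mp hx
  obtain ⟨hVt, hxV⟩ := Opens.mem_iSup.mp hV
  rw [stalkIdeal_pow, stalkIdeal_eq_map_germ I V hxV, stalkIdeal_eq_map_germ J V hxV,
    ← Ideal.map_pow]
  refine Ideal.map_mono ((Ideal.pow_le_pow_right ?_).trans (hnU V))
  exact (Finset.le_sup (f := nU) hVt).trans (Nat.le_succ _)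

/-- **On a Noetherian scheme, if `V(J) ⊆ V(I)` then `Iᴺ ⊆ J` for some `N ≥ 1`.** [folklore] -/
theorem exists_pow_succ_le_of_support_subset [IsLocallyNoetherian X] [CompactSpace X]
    {I J : X.IdealSheafData} (h : (J.support : Set X) ⊆ I.support) : ∃ N : ℕ, I ^ (N + 1) ≤ J :=
  exists_pow_succ_le_of_le_radical (by
    rw [← vanishingIdeal_support]
    exact le_support_iff_le_vanishingIdeal.mp fun x hx => h hx)

/-- **Stalks from an equality of pull-backs along an open immersion**: if `I|_U = J|_U` along
an open immersion `f : U → X`, then `I_{f u} = J_{f u}`. [folklore] -/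
theorem stalkIdeal_eq_of_comap_eq_of_isOpenImmersion {U : Scheme.{u}} (f : U ⟶ X)
    [IsOpenImmersion f] {I J : X.IdealSheafData} (h : I.comap f = J.comap f) (u : U) :
    stalkIdeal I (f u) = stalkIdeal J (f u) := by
  have key := congrArg (fun L => stalkIdeal L u) h
  simp only [stalkIdeal_comap_eq_map_stalkMap] at key
  exact ideal_eq_of_map_ringEquiv_eq_loc (asIso (f.stalkMap u)).commRingCatIsoToRingEquiv key

end Noetherian

namespace CentreSeq

variable {A : Type u} [CommRing A] (a : A)

/-! ## Pointwise forms over a basic open of the base -/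

/-- **Centres over `T` at the points over `D(a)`**: every centre of `s` has its support, AT THE
POINTS OF THE TOWER OVER `D(a)`, inside the preimage of `T`. [folklore] -/
def CentresOverAt : {X : Scheme.{u}} → (X ⟶ Spec (.of A)) → CentreSeq X → Set X → Prop
  | _, _, nil _, _ => True
  | X, q, cons C rest, T =>
      (∀ x : X, q x ∈ (basicOpen a : Set (PrimeSpectrum A)) → x ∈ C.support → x ∈ T) ∧
        CentresOverAt (blowup.π C ≫ q) rest (blowup.π C ⁻¹' T)

/-- **The single blow-up of `J` off `Z`, at the points over `D(a)`** (pointwise form of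
`IsSingleOff`): a number of steps whose centres are supported over `Z` at the points over
`D(a)`, then ONE step whose centre has the same stalks as (the pull-back of) `J` at the points
over `D(a)` off `Z`, then steps with centres over `Z` at the points over `D(a)`.
[cite: BierstoneGrigorievMilmanWlodarczyk2011, Thm. 8.0.5 (2) with Def. 3.1.5] -/
def SingleOffAt : {X : Scheme.{u}} → (X ⟶ Spec (.of A)) → CentreSeq X → Set X →
    X.IdealSheafData → Prop
  | _, _, nil _, _, _ => False
  | X, q, cons C rest, Z, J =>
      ((∀ x : X, q x ∈ (basicOpen a : Set (PrimeSpectrum A)) → x ∈ C.support → x ∈ Z) ∧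
          SingleOffAt (blowup.π C ≫ q) rest (blowup.π C ⁻¹' Z) (J.comap (blowup.π C))) ∨
        ((∀ x : X, q x ∈ (basicOpen a : Set (PrimeSpectrum A)) → x ∉ Z →
            stalkIdeal C x = stalkIdeal J x) ∧
          CentresOverAt a (blowup.π C ≫ q) rest (blowup.π C ⁻¹' Z))

/-- Monotonicity of `CentresOverAt` in the basic open. [folklore] -/
theorem CentresOverAt.mono {a b : A} (hab : basicOpen b ≤ basicOpen a) :
    ∀ {X : Scheme.{u}} {q : X ⟶ Spec (.of A)} {s : CentreSeq X} {T : Set X},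
      CentresOverAt a q s T → CentresOverAt b q s T
  | _, _, nil _, _, _ => trivial
  | _, _, cons _ _, _, h => ⟨fun x hx hxC => h.1 x (hab hx) hxC, CentresOverAt.mono hab h.2⟩

/-- Monotonicity of `SingleOffAt` in the basic open. [folklore] -/
theorem SingleOffAt.mono {a b : A} (hab : basicOpen b ≤ basicOpen a) :
    ∀ {X : Scheme.{u}} {q : X ⟶ Spec (.of A)} {s : CentreSeq X} {Z : Set X}
      {J : X.IdealSheafData}, SingleOffAt a q s Z J → SingleOffAt b q s Z J
  | _, _, nil _, _, _, h => (h : False).elim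
  | _, _, cons _ _, _, _, h => by
    rcases h with ⟨hC, hrest⟩ | ⟨hCJ, hrest⟩
    · exact Or.inl ⟨fun x hx hxC => hC x (hab hx) hxC, SingleOffAt.mono hab hrest⟩
    · exact Or.inr ⟨fun x hx hxZ => hCJ x (hab hx) hxZ, CentresOverAt.mono hab hrest⟩

/-! ## Restriction to the preimage of `D(a)` -/

/-- The preimage of the preimage under the two ways round the square `Bl(j) ≫ π = π₀ ≫ j`.
[folklore] -/
theorem preimage_blowupMap_preimage_π {X X₀ : Scheme.{u}} (C : X.IdealSheafData) (j : X₀ ⟶ X)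
    [IsOpenImmersion j] (T : Set X) :
    blowup.map C j ⁻¹' (blowup.π C ⁻¹' T) = blowup.π (C.comap j) ⁻¹' (j ⁻¹' T) := by
  rw [← Set.preimage_comp, ← Set.preimage_comp, ← TopCat.coe_comp, ← TopCat.coe_comp,
    ← Scheme.Hom.comp_base, ← Scheme.Hom.comp_base, blowup.map_π]

/-- **Restriction of `CentresOverAt`**: along an open immersion `j` whose image is the set of
points over `D(a)`, the restricted sequence has its centres over `j⁻¹ T`. [folklore] -/
theorem CentresOverAt.centresOver_restrict :
    ∀ {X : Scheme.{u}} (s : CentreSeq X) (q : X ⟶ Spec (.of A)) (T : Set X),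
      CentresOverAt a q s T → ∀ {X₀ : Scheme.{u}} (j : X₀ ⟶ X) [IsOpenImmersion j],
        (∀ x : X, x ∈ Set.range j ↔ q x ∈ (basicOpen a : Set (PrimeSpectrum A))) →
        (s.restrict j).CentresOver (j ⁻¹' T)
  | _, nil _, _, _, _, _, _, _, _ => trivial
  | X, cons C rest, q, T, h, X₀, j, _, hj => by
    obtain ⟨hC, hrest⟩ := h
    rw [restrict_cons]
    refine (centresOver_cons (C.comap j) _ _).mpr ⟨?_, ?_⟩
    · intro u hu
      rw [Scheme.IdealSheafData.support_comap] at hu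
      exact hC (j u) ((hj (j u)).mp ⟨u, rfl⟩) hu
    · have hj₁ : ∀ x : blowup C, x ∈ Set.range (blowup.map C j) ↔
          (blowup.π C ≫ q) x ∈ (basicOpen a : Set (PrimeSpectrum A)) := fun x => by
        rw [blowup.range_map, Set.mem_preimage, hj, Scheme.Hom.comp_apply]
      have ih := CentresOverAt.centresOver_restrict rest (blowup.π C ≫ q) (blowup.π C ⁻¹' T) hrest
        (blowup.map C j) hj₁
      rwa [preimage_blowupMap_preimage_π] at ih

/-- **Restriction of `SingleOffAt`**: along an open immersion `j` whose image is the set of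
points over `D(a)`, the restricted sequence is the single blow-up of `j^*J` off `j⁻¹ Z`, for `Z`
closed (the step with the same stalks as `J` off `Z` agrees with `j^*J` on the open complement
of `j⁻¹ Z`, `EqOff.of_comap_eq`). [cite: BierstoneGrigorievMilmanWlodarczyk2011, Thm. 8.0.5 (2) with Def. 3.1.5] -/
theorem SingleOffAt.isSingleOff_restrict :
    ∀ {X : Scheme.{u}} (s : CentreSeq X) (q : X ⟶ Spec (.of A)) (Z : Set X)
      (J : X.IdealSheafData), SingleOffAt a q s Z J → IsClosed Z →
      ∀ {X₀ : Scheme.{u}} (j : X₀ ⟶ X) [IsOpenImmersion j],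
        (∀ x : X, x ∈ Set.range j ↔ q x ∈ (basicOpen a : Set (PrimeSpectrum A))) →
        (s.restrict j).IsSingleOff (j ⁻¹' Z) (J.comap j)
  | _, nil _, _, _, _, h, _, _, _, _, _ => (h : False).elim
  | X, cons C rest, q, Z, J, h, hZ, X₀, j, _, hj => by
    have hj₁ : ∀ x : blowup C, x ∈ Set.range (blowup.map C j) ↔
        (blowup.π C ≫ q) x ∈ (basicOpen a : Set (PrimeSpectrum A)) := fun x => by
      rw [blowup.range_map, Set.mem_preimage, hj, Scheme.Hom.comp_apply]
    have hjx : ∀ u : X₀, q (j u) ∈ (basicOpen a : Set (PrimeSpectrum A)) := fun u =>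
      (hj (j u)).mp ⟨u, rfl⟩
    rw [restrict_cons]
    rcases h with ⟨hC, hrest⟩ | ⟨hCJ, hrest⟩
    · refine IsSingleOff.cons_over ?_ ?_
      · intro u hu
        rw [Scheme.IdealSheafData.support_comap] at hu
        exact hC (j u) (hjx u) hu
      · have ih := SingleOffAt.isSingleOff_restrict rest (blowup.π C ≫ q) (blowup.π C ⁻¹' Z)
          (J.comap (blowup.π C)) hrest (hZ.preimage (blowup.π C).continuous) (blowup.map C j) hj₁
        rwa [preimage_blowupMap_preimage_π, ← Scheme.IdealSheafData.comap_comp, blowup.map_π,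
          Scheme.IdealSheafData.comap_comp] at ih
    · refine IsSingleOff.cons_eqOff ?_ ?_
      · -- the centre agrees with `j^*J` on the open complement `W` of `j⁻¹ Z`
        let W : X₀.Opens := ⟨(j ⁻¹' Z)ᶜ, (hZ.preimage j.continuous).isOpen_compl⟩
        refine EqOff.of_comap_eq W.ι ?_ (by rw [Scheme.Opens.range_ι]; exact fun u hu => hu)
        rw [← Scheme.IdealSheafData.comap_comp, ← Scheme.IdealSheafData.comap_comp]
        refine comap_eq_comap_of_forall_stalkIdeal_eq (W.ι ≫ j) fun w => ?_
        rw [Scheme.Hom.comp_apply]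
        exact hCJ (j (W.ι w)) (hjx _) (by rw [Scheme.Opens.ι_apply]; exact w.2)
      · have ih := CentresOverAt.centresOver_restrict a rest (blowup.π C ≫ q) (blowup.π C ⁻¹' Z)
          hrest (blowup.map C j) hj₁
        rwa [preimage_blowupMap_preimage_π] at ih

/-! ## Spreading out from the generic fibre -/

section Spread

variable [IsDomain A] [IsNoetherianRing A] (K : Type u) [Field K] [Algebra A K]
  [IsFractionRing A K]

/-- The preimage of the preimage under the two ways round the square `g ≫ π = π_K ≫ jK` of the
blow-ups of `X` along `C` and of `X_K` along `jK^*C`. [folklore] -/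
theorem preimage_comapMap_preimage_π {X XK : Scheme.{u}} (C : X.IdealSheafData) (jK : XK ⟶ X)
    (T : Set X) :
    blowup.comapMap C jK ⁻¹' (blowup.π C ⁻¹' T) = blowup.π (C.comap jK) ⁻¹' (jK ⁻¹' T) := by
  rw [← Set.preimage_comp, ← Set.preimage_comp, ← TopCat.coe_comp, ← TopCat.coe_comp,
    ← Scheme.Hom.comp_base, ← Scheme.Hom.comp_base, blowup.comapMap_π]

/-- **A centre supported over `Z` on the generic fibre is supported over `Z` at the points over
some `D(a)`, `a ≠ 0`** (see the module docstring). [folklore] -/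
theorem exists_forall_mem_of_support_comap_subset {X XK : Scheme.{u}} [IsLocallyNoetherian XK]
    (q : X ⟶ Spec (.of A)) [LocallyOfFiniteType q] [QuasiCompact q] {jK : XK ⟶ X}
    {qK : XK ⟶ Spec (.of K)} (HK : IsPullback jK qK q (specOfAlgebra A K))
    (C : X.IdealSheafData) {Z : Set X} (hZ : IsClosed Z)
    (h : ((C.comap jK).support : Set XK) ⊆ jK ⁻¹' Z) :
    ∃ a : A, a ≠ 0 ∧ ∀ x : X, q x ∈ (basicOpen a : Set (PrimeSpectrum A)) →
      x ∈ C.support → x ∈ Z := by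
  haveI : IsLocallyNoetherian X := LocallyOfFiniteType.isLocallyNoetherian q
  haveI : CompactSpace X := QuasiCompact.compactSpace_of_compactSpace q
  haveI : IsAffineHom jK := isAffineHom_of_isPullback_generic K q HK
  haveI : CompactSpace XK := QuasiCompact.compactSpace_of_compactSpace jK
  -- the vanishing ideal sheaf `H` of `Z`
  set H : X.IdealSheafData := vanishingIdeal ⟨Z, hZ⟩ with hH
  have hHsupp : ∀ x : X, x ∈ H.support ↔ x ∈ Z := fun x => by
    rw [← SetLike.mem_coe, hH, coe_support_vanishingIdeal]
    rfl
  -- generically `supp (jK^*C) ⊆ supp (jK^*H)`, so `(jK^*H)ᴺ⁺¹ ⊆ jK^*C`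
  have hsub : ((C.comap jK).support : Set XK) ⊆ (H.comap jK).support := fun x hx => by
    have hx' := h hx
    rw [SetLike.mem_coe, Scheme.IdealSheafData.support_comap]
    exact (hHsupp (jK x)).mpr hx'
  obtain ⟨N, hN⟩ := exists_pow_succ_le_of_support_subset hsub
  have hle : (H ^ (N + 1)).comap (pullback.fst q (specOfAlgebra A K)) ≤
      C.comap (pullback.fst q (specOfAlgebra A K)) := by
    rw [comap_pullback_fst_eq_comap_comap_loc K q HK, comap_pullback_fst_eq_comap_comap_loc K q HK,
      comap_pow]
    exact Scheme.IdealSheafData.comap_mono _ hN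
  -- spread the inclusion and read it on stalks
  obtain ⟨a, ha, hle'⟩ := exists_comap_ι_le_comap_ι_of_generic K q (H ^ (N + 1)) C hle
  refine ⟨a, ha, fun x hx hxC => ?_⟩
  have h1 : stalkIdeal (H ^ (N + 1)) x ≤ stalkIdeal C x := stalkIdeal_le_of_comap_ι_le_loc hle' hx
  have h2 : x ∈ (H ^ (N + 1)).support := by
    rw [mem_support_iff_stalkIdeal_le] at hxC ⊢
    exact h1.trans hxC
  rw [support_pow_succ] at h2
  exact (hHsupp x).mp h2

/-- **Two ideal sheaves agreeing off `jK⁻¹ Z` on the generic fibre have the same stalks off `Z`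
at the points over some `D(a)`, `a ≠ 0`** (see the module docstring). [folklore] -/
theorem exists_forall_stalkIdeal_eq_of_eqOff_comap {X XK : Scheme.{u}}
    (q : X ⟶ Spec (.of A)) [LocallyOfFiniteType q] [QuasiCompact q] {jK : XK ⟶ X}
    {qK : XK ⟶ Spec (.of K)} (HK : IsPullback jK qK q (specOfAlgebra A K))
    (C J : X.IdealSheafData) {Z : Set X} (hZ : IsClosed Z)
    (h : EqOff (C.comap jK) (J.comap jK) (jK ⁻¹' Z)) :
    ∃ a : A, a ≠ 0 ∧ ∀ x : X, q x ∈ (basicOpen a : Set (PrimeSpectrum A)) → x ∉ Z →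
      stalkIdeal C x = stalkIdeal J x := by
  haveI : IsLocallyNoetherian X := LocallyOfFiniteType.isLocallyNoetherian q
  haveI : CompactSpace X := QuasiCompact.compactSpace_of_compactSpace q
  -- the open complement `W` of `Z`, an `A`-scheme of finite type with generic fibre `jK⁻¹ W`
  let W : X.Opens := ⟨Zᶜ, hZ.isOpen_compl⟩
  haveI : CompactSpace (W : Scheme.{u}) := QuasiCompact.compactSpace_of_compactSpace W.ι
  have HKW : IsPullback (jK ∣_ W) ((jK ⁻¹ᵁ W).ι ≫ qK) (W.ι ≫ q) (specOfAlgebra A K) :=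
    (isPullback_morphismRestrict jK W).paste_vert HK
  have hgen : (C.comap W.ι).comap (jK ∣_ W) = (J.comap W.ι).comap (jK ∣_ W) := by
    rw [← Scheme.IdealSheafData.comap_comp, ← Scheme.IdealSheafData.comap_comp, morphismRestrict_ι,
      Scheme.IdealSheafData.comap_comp, Scheme.IdealSheafData.comap_comp]
    refine h (jK ⁻¹ᵁ W).ι ?_
    rw [Scheme.Opens.range_ι]
    exact fun x hx => hx
  have hgen' : (C.comap W.ι).comap (pullback.fst (W.ι ≫ q) (specOfAlgebra A K)) =
      (J.comap W.ι).comap (pullback.fst (W.ι ≫ q) (specOfAlgebra A K)) := by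
    rw [comap_pullback_fst_eq_comap_comap_loc K (W.ι ≫ q) HKW,
      comap_pullback_fst_eq_comap_comap_loc K (W.ι ≫ q) HKW, hgen]
  obtain ⟨a, ha, heq⟩ :=
    exists_comap_ι_eq_comap_ι_of_generic K (W.ι ≫ q) (C.comap W.ι) (J.comap W.ι) hgen'
  refine ⟨a, ha, fun x hx hxZ => ?_⟩
  have hxW : x ∈ W := hxZ
  have key := stalkIdeal_eq_of_comap_ι_eq_loc heq (x := (⟨x, hxW⟩ : W))
    (show (⟨x, hxW⟩ : W) ∈ (W.ι ≫ q) ⁻¹ᵁ basicOpen a from hx)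
  have key' := fun (I : X.IdealSheafData) =>
    stalkIdeal_comap_eq_map_stalkMap W.ι I (⟨x, hxW⟩ : W)
  rw [key' C, key' J] at key
  exact ideal_eq_of_map_ringEquiv_eq_loc (asIso (W.ι.stalkMap ⟨x, hxW⟩)).commRingCatIsoToRingEquiv key

/-- **Spreading out `CentresOver`**: if `jK^*(s)` has its centres over `jK⁻¹ T` (`T` closed),
then `s` has its centres over `T` at the points over some `D(a)`, `a ≠ 0`. [folklore] -/
theorem exists_centresOverAt :
    ∀ {X XK : Scheme.{u}} [IsLocallyNoetherian XK] (s : CentreSeq X) (q : X ⟶ Spec (.of A))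
      [LocallyOfFiniteType q] [QuasiCompact q] (jK : XK ⟶ X) (qK : XK ⟶ Spec (.of K)),
      IsPullback jK qK q (specOfAlgebra A K) → ∀ {T : Set X}, IsClosed T →
      (s.comap jK).CentresOver (jK ⁻¹' T) → ∃ a : A, a ≠ 0 ∧ CentresOverAt a q s T
  | X, _, _, nil _, _, _, _, _, _, _, _, _, _ => ⟨1, one_ne_zero, trivial⟩
  | X, XK, _, cons C rest, q, _, _, jK, qK, HK, T, hT, h => by
    haveI : IsLocallyNoetherian X := LocallyOfFiniteType.isLocallyNoetherian q
    haveI : Flat jK := flat_of_isPullback_generic K q HK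
    haveI : IsProper (blowup.π C) := (blowup.isBlowup C).isProper
    haveI : IsProper (blowup.π (C.comap jK)) := (blowup.isBlowup (C.comap jK)).isProper
    haveI : IsLocallyNoetherian (blowup (C.comap jK)) :=
      LocallyOfFiniteType.isLocallyNoetherian (blowup.π (C.comap jK))
    set g : blowup (C.comap jK) ⟶ blowup C := blowup.comapMap C jK with hg
    have HK₁ : IsPullback g (blowup.π (C.comap jK) ≫ qK) (blowup.π C ≫ q) (specOfAlgebra A K) :=
      (blowup.isPullback_comapMap C jK).paste_vert HK
    haveI : LocallyOfFiniteType (blowup.π C ≫ q) := inferInstance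
    haveI : QuasiCompact (blowup.π C ≫ q) := inferInstance
    have h' : (cons (C.comap jK) (rest.comap g)).CentresOver (jK ⁻¹' T) := h
    obtain ⟨hC, hrest⟩ := (centresOver_cons _ _ _).mp h'
    obtain ⟨a₁, ha₁, h₁⟩ := exists_forall_mem_of_support_comap_subset K q HK C hT hC
    rw [← preimage_comapMap_preimage_π] at hrest
    obtain ⟨a₂, ha₂, h₂⟩ := exists_centresOverAt rest (blowup.π C ≫ q) g
      (blowup.π (C.comap jK) ≫ qK) HK₁ (hT.preimage (blowup.π C).continuous) hrest
    refine ⟨a₁ * a₂, mul_ne_zero ha₁ ha₂, fun x hx hxC => h₁ x ?_ hxC,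
      CentresOverAt.mono ?_ h₂⟩
    · rw [basicOpen_mul] at hx
      exact hx.1
    · rw [basicOpen_mul]
      exact inf_le_right

/-- **Spreading out `IsSingleOff`**: if `jK^*(s)` is the single blow-up of `jK^*J` off `jK⁻¹ Z`
(`Z` closed), then `s` is the single blow-up of `J` off `Z` at the points over some `D(a)`,
`a ≠ 0`. [cite: BierstoneGrigorievMilmanWlodarczyk2011, Thm. 8.0.5 (2) with Cor. 8.0.6–8.0.7] -/
theorem exists_singleOffAt :
    ∀ {X XK : Scheme.{u}} [IsLocallyNoetherian XK] (s : CentreSeq X) (q : X ⟶ Spec (.of A))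
      [LocallyOfFiniteType q] [QuasiCompact q] (jK : XK ⟶ X) (qK : XK ⟶ Spec (.of K)),
      IsPullback jK qK q (specOfAlgebra A K) → ∀ {Z : Set X} (J : X.IdealSheafData), IsClosed Z →
      (s.comap jK).IsSingleOff (jK ⁻¹' Z) (J.comap jK) → ∃ a : A, a ≠ 0 ∧ SingleOffAt a q s Z J
  | X, _, _, nil _, _, _, _, _, _, _, _, _, _, h => (h : False).elim
  | X, XK, _, cons C rest, q, _, _, jK, qK, HK, Z, J, hZ, h => by
    haveI : IsLocallyNoetherian X := LocallyOfFiniteType.isLocallyNoetherian q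
    haveI : Flat jK := flat_of_isPullback_generic K q HK
    haveI : IsProper (blowup.π C) := (blowup.isBlowup C).isProper
    haveI : IsProper (blowup.π (C.comap jK)) := (blowup.isBlowup (C.comap jK)).isProper
    haveI : IsLocallyNoetherian (blowup (C.comap jK)) :=
      LocallyOfFiniteType.isLocallyNoetherian (blowup.π (C.comap jK))
    set g : blowup (C.comap jK) ⟶ blowup C := blowup.comapMap C jK with hg
    have hsq : g ≫ blowup.π C = blowup.π (C.comap jK) ≫ jK := blowup.comapMap_π C jK
    have HK₁ : IsPullback g (blowup.π (C.comap jK) ≫ qK) (blowup.π C ≫ q) (specOfAlgebra A K) :=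
      (blowup.isPullback_comapMap C jK).paste_vert HK
    haveI : LocallyOfFiniteType (blowup.π C ≫ q) := inferInstance
    haveI : QuasiCompact (blowup.π C ≫ q) := inferInstance
    have hZ₁ : IsClosed (blowup.π C ⁻¹' Z) := hZ.preimage (blowup.π C).continuous
    have h' : (cons (C.comap jK) (rest.comap g)).IsSingleOff (jK ⁻¹' Z) (J.comap jK) := h
    rcases h' with ⟨hC, hrest⟩ | ⟨hCJ, hrest⟩
    · obtain ⟨a₁, ha₁, h₁⟩ := exists_forall_mem_of_support_comap_subset K q HK C hZ hC
      rw [← preimage_comapMap_preimage_π, ← Scheme.IdealSheafData.comap_comp, ← hsq,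
        Scheme.IdealSheafData.comap_comp] at hrest
      obtain ⟨a₂, ha₂, h₂⟩ := exists_singleOffAt rest (blowup.π C ≫ q) g
        (blowup.π (C.comap jK) ≫ qK) HK₁ (J.comap (blowup.π C)) hZ₁ hrest
      refine ⟨a₁ * a₂, mul_ne_zero ha₁ ha₂, Or.inl ⟨fun x hx hxC => h₁ x ?_ hxC,
        SingleOffAt.mono ?_ h₂⟩⟩
      · rw [basicOpen_mul] at hx
        exact hx.1
      · rw [basicOpen_mul]
        exact inf_le_right
    · obtain ⟨a₁, ha₁, h₁⟩ := exists_forall_stalkIdeal_eq_of_eqOff_comap K q HK C J hZ hCJ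
      rw [← preimage_comapMap_preimage_π] at hrest
      obtain ⟨a₂, ha₂, h₂⟩ := exists_centresOverAt K rest (blowup.π C ≫ q) g
        (blowup.π (C.comap jK) ≫ qK) HK₁ hZ₁ hrest
      refine ⟨a₁ * a₂, mul_ne_zero ha₁ ha₂, Or.inr ⟨fun x hx hxZ => h₁ x ?_ hxZ,
        CentresOverAt.mono ?_ h₂⟩⟩
      · rw [basicOpen_mul] at hx
        exact hx.1
      · rw [basicOpen_mul]
        exact inf_le_right

/-- **Conclusion: the shape spreads out.** If `jK^*(s)` is the single blow-up of `jK^*J` off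
`jK⁻¹ Z` (`Z ⊆ X` closed), then there is `a ≠ 0` such that for every `b` with `D(b) ⊆ D(a)` and
every open immersion `j` whose image is the set of points over `D(b)`, the restriction `s|_{j}` is
the single blow-up of `j^*J` off `j⁻¹ Z`.
[cite: BierstoneGrigorievMilmanWlodarczyk2011, Thm. 8.0.5 (2) with Cor. 8.0.6–8.0.7] -/
theorem exists_isSingleOff_restrict {X XK : Scheme.{u}} [IsLocallyNoetherian XK] (s : CentreSeq X)
    (q : X ⟶ Spec (.of A)) [LocallyOfFiniteType q] [QuasiCompact q] (jK : XK ⟶ X)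
    (qK : XK ⟶ Spec (.of K)) (HK : IsPullback jK qK q (specOfAlgebra A K)) {Z : Set X}
    (J : X.IdealSheafData) (hZ : IsClosed Z) (h : (s.comap jK).IsSingleOff (jK ⁻¹' Z) (J.comap jK)) :
    ∃ a : A, a ≠ 0 ∧ ∀ b : A, basicOpen b ≤ basicOpen a →
      ∀ {X₀ : Scheme.{u}} (j : X₀ ⟶ X) [IsOpenImmersion j],
        (∀ x : X, x ∈ Set.range j ↔ q x ∈ (basicOpen b : Set (PrimeSpectrum A))) →
        (s.restrict j).IsSingleOff (j ⁻¹' Z) (J.comap j) := by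
  obtain ⟨a, ha, h⟩ := exists_singleOffAt K s q jK qK HK J hZ h
  exact ⟨a, ha, fun b hb X₀ j _ hj =>
    SingleOffAt.isSingleOff_restrict b s q Z J (SingleOffAt.mono hb h) hZ j hj⟩

end Spread

end CentreSeq

end Literature.AlgebraicGeometry.Resolution

end
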